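import Summits.ResolutionOfSingularities.ResolutionOfSingularities.Theorems.TwistCutOrderUSC
import Literature.AlgebraicGeometry.Resolution.RegularBlowup
import Literature.AlgebraicGeometry.Resolution.BlowupReducedDimension
import HarnessLib

/-!
# TwistCutBaseStable — decomp-res node «TwistCut» rev4 (lens-6 g21), tree file 6/6 of the node

Content VERBATIM from the decomp-res lens-6 g21 rev4 node file `HOME/decomp-res-lens-6/g21/TwistCutComplete.lean`
(sha f416642f, 1 375 l;
HOME = run/shared/lean/pub/decomp-res; rc 0 · 0 sorry · standard axioms; = `TwistCutFinal.lean` a36321ac + two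
imports + §14, machine diff = pure
insertions; earlier parts in the tree as `TwistCutOperators` · `TwistCutLaw` · `TwistCutCells` ·
`TwistCutElimination` · `TwistCutOrderUSC`, imported,
not repeated): its §14 ONLY.  Critic: CRITIC-LEDGER row 161c (0·0 hygiene: the costume `BaseStable` PROVED — the
twist line is port-free and
costume-free; increments of rows 159/161 stand); landing orders INBOX :640 (source of truth §1–§14, NO port item, NO
costume hypothesis; headline
`e_one_iff_e1TopNonSplit`; the ONE located-residual aside of the column = `E1TopNonSplit`), package NODE-g21-rev4.md
f1956265 §4 (file 6 of 6).

## This file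

§14 THE COSTUME `BaseStable` DISCHARGED from tree facts: **`baseStable_holds`** (blow-up of a regular separated
finite-type quasi-compact `Y/k` of
dimension ≤ 4 along a regular centre is again such — `IsBlowup.isRegular_of_isRegular_subscheme`, `IsBlowup.isProper`,
`IsBlowup.topologicalKrullDim_le_of_isLocallyNoetherian`); consequences `worTopOnlySplit_of_allAbs`,
`e1TopNoAbs_iff_e1TopNonSplit'`,
**`e_one_iff_e1TopNonSplit : SubfieldContactAbs → E 5 → (E 1 ↔ E1TopNonSplit)`** (the located residual of `E 1` is
EXACTLY the non-split wild
cell) and `e_one_of_nonSplit'`.  Cone-free.  Imports `TwistCutOrderUSC` + Literature `RegularBlowup` / `BlowupReducedDimension`.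

[WRITER NOTE (decomp-res writer g9): one tree file (≤ 400 lines); namespace, universe, sections, section opens and
every declaration exactly as
in the lens.]

(Sources: Liu2002 Thm 8.1.19 (a), §8.1; GortzWedhorn2020 Prop. 13.91/13.96; EGAIV4 16.8; CossartJannsenSaito2020 §4;
CossartPiltant2019.)
-/

noncomputable section

open CategoryTheory AlgebraicGeometry TopologicalSpace IsLocalRing
open Literature.AlgebraicGeometry.Resolution

universe u

namespace Summit.ResolutionOfSingularities.ResolutionOfSingularities.Theorems.TwistCutClasses

section BaseStableHolds

open Summit.ResolutionOfSingularities.ResolutionOfSingularities.Theorems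
open WeakOrderReduction ForcedTowerClasses SubfieldContactClasses AbsoluteContactClasses PurityValveClasses

/-! ## §14 THE COSTUME `BaseStable` DISCHARGED from tree facts (Liu 8.1.19 (a); properness; dimension of blow-ups) -/

/-- **`BaseStable` holds** (PROVED from the tree): the blow-up of a regular separated finite-type quasi-compact `Y/k` of
dimension `≤ 4` along a regular centre is again such — regularity by `IsBlowup.isRegular_of_isRegular_subscheme` (Liu2002 Thm.
8.1.19 (a)), separated / finite type / quasi-compact by properness of blow-ups (`IsBlowup.isProper`), dimension by
`IsBlowup.topologicalKrullDim_le_of_isLocallyNoetherian`. (Sources: Liu2002, Thm. 8.1.19 (a).) -/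
theorem baseStable_holds : BaseStable := by
  intro k _ Y g hB C hCreg
  haveI := hB.locallyOfFiniteType
  haveI : IsLocallyNoetherian Y := LocallyOfFiniteType.isLocallyNoetherian g
  haveI := hB.isSeparated
  haveI := hB.quasiCompact
  have hπ := blowup.isBlowup C
  haveI : IsProper (blowup.π C) := hπ.isProper
  have h4 : topologicalKrullDim Y ≤ ((4 : ℕ) : WithBot ℕ∞) := by exact_mod_cast hB.dim_le
  have h4' := hπ.topologicalKrullDim_le_of_isLocallyNoetherian h4
  exact { isSeparated := inferInstance
          locallyOfFiniteType := inferInstance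
          quasiCompact := inferInstance
          isRegular := hπ.isRegular_of_isRegular_subscheme hB.isRegular hCreg
          dim_le := by exact_mod_cast h4' }

/-- **THE DECIDED CELL, UNCONDITIONALLY ON THE BASE SIDE** (PROVED): `WORAllAbs n → WORTopOnlySplit n` for `n ≥ 1`.
[new] [folklore] -/
theorem worTopOnlySplit_of_allAbs {n : ℕ} (hn : 1 ≤ n) (hA : WORAllAbs n) : WORTopOnlySplit n :=
  worTopOnlySplit_of_baseStable baseStable_holds hn hA

/-- **THE RE-LOCATION, unconditional form**: `SubfieldContactAbs → E 5 → (E1TopNoAbs ↔ E1TopNonSplit)`. [new] [folklore] -/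
theorem e1TopNoAbs_iff_e1TopNonSplit' (hSC : SubfieldContactAbs) (h5 : E 5) : E1TopNoAbs ↔ E1TopNonSplit :=
  e1TopNoAbs_iff_e1TopNonSplit_of_baseStable baseStable_holds hSC h5

/-- **`E 1 ↔ E1TopNonSplit`** given the tame engine `SubfieldContactAbs` (proved, g20) and `E 5`: the located residual of
`E 1` is now EXACTLY the non-split wild cell. [new] [folklore] -/
theorem e_one_iff_e1TopNonSplit (hSC : SubfieldContactAbs) (h5 : E 5) : E 1 ↔ E1TopNonSplit :=
  (e_one_iff_topNoAbs hSC h5).trans (e1TopNoAbs_iff_e1TopNonSplit' hSC h5)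

/-- **Summit edge, unconditional form**: `SubfieldContactAbs → E 5 → E1TopNonSplit → E 1`. [new] [folklore] -/
theorem e_one_of_nonSplit' (hSC : SubfieldContactAbs) (h5 : E 5) (hR : E1TopNonSplit) : E 1 :=
  (e_one_iff_e1TopNonSplit hSC h5).2 hR

end BaseStableHolds

end Summit.ResolutionOfSingularities.ResolutionOfSingularities.Theorems.TwistCutClasses
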